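import Mathlib
import HarnessLib

/-!
# The LCU lemma: implementing a linear combination of unitaries (Childs–Kothari–Somma 2017, Lemma 6)

HONEST FRAMING: instance-level adjudication of specific advantage claims; no claim about
BQP vs BPP or the summit.

[cite: ChildsKothariSomma2017, §2.1] (A. M. Childs, R. Kothari, R. D. Somma, *Quantum algorithm
for systems of linear equations with exponentially improved dependence on precision*, SIAM J.
Comput. 46 (2017) 1920–1950 = arXiv:1511.02306), verbatim (held text `paper:arxiv-1511.02306`
p0007):

> "Let `M = ∑_i α_i U_i` be a linear combination of unitary matrices `U_i` with `α_i > 0`. …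
> The operation `U := ∑_i |i⟩⟨i| ⊗ U_i` implements `U_i` conditioned on the value of a control
> register. The operation `V` maps `|0^m⟩` to `(1/√α) ∑_i √α_i |i⟩`, where
> `α := ‖α‖₁ = ∑_i α_i`. Then, as shown in [Kot14], we can implement `M` in the following sense.
>
> **Lemma 6.** Let `M = ∑_i α_i U_i` be a linear combination of unitaries `U_i` with `α_i > 0`
> for all `i`. Let `V` be any operator that satisfies `V|0^m⟩ := (1/√α) ∑_i √α_i |i⟩`, where
> `α := ∑_i α_i`. Then `W := V†UV` satisfies `W|0^m⟩|ψ⟩ = (1/α)|0^m⟩M|ψ⟩ + |Ψ^⊥⟩` for all states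
> `|ψ⟩`, where `U := ∑_i |i⟩⟨i| ⊗ U_i` and `(|0^m⟩⟨0^m| ⊗ 𝟙)|Ψ^⊥⟩ = 0`."
>
> "… if we measure the first `m` qubits of `W|0^m⟩|ψ⟩` and observe the output `|0^m⟩`, the state
> of the second register is proportional to `M|ψ⟩`. This successful outcome occurs with
> probability `(‖M|ψ⟩‖/α)²`."

and the introductory example (p0005): "consider implementing the operator `M = U_0 + U_1` … we
start with the state `|+⟩|ψ⟩` … perform the unitary `|0⟩⟨0| ⊗ U_0 + |1⟩⟨1| ⊗ U_1` … If we measure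
the first qubit in the `{|+⟩,|−⟩}` basis and obtain the `|+⟩` outcome, then we prepare a state
proportional to `M|ψ⟩`."

Rendering.  The control register is a finite index type `ι` with a distinguished basis label
`i₀` (the paper's `|0^m⟩`), the system a finite index type `n`; operators on the joint space are
matrices indexed by `ι × n`.  `selectOp U = ∑_i |i⟩⟨i| ⊗ U_i`, `onControl V = V ⊗ 𝟙`,
`lcuOp V U = (V† ⊗ 𝟙)(∑_i |i⟩⟨i| ⊗ U_i)(V ⊗ 𝟙)` (= the paper's `W = V†UV` with `V` acting on the
control register), `ketTensor i ψ = |i⟩|ψ⟩`.  The hypothesis on `V` is exactly the printed one, on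
its `i₀`-column: `V i i₀ = √(α_i/α)`.  As in the printed proof, NO unitarity is needed for the
identity itself (`⟨0^m|V† = (V|0^m⟩)†` holds for every `V`); unitarity of the `U_i` and of `V`
only makes `W` a unitary, recorded separately (`selectOp_conjTranspose_mul_selectOp`).

What is here (all proved; 0 named facts):
* **`lcuOp_block`** — the `|0^m⟩`-block of `W` is `M/α`:
  `W_{(i₀,a),(i₀,b)} = (1/α) ∑_i α_i (U_i)_{ab}`;
* **`lcuOp_mulVec_ketTensor_zero`** — Lemma 6 on vectors: the `|0^m⟩`-component of `W|0^m⟩|ψ⟩`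
  is `(1/α) M|ψ⟩`, and **`proj_remainder_eq_zero`** — the remainder
  `|Ψ^⊥⟩ := W|0^m⟩|ψ⟩ − |0^m⟩(M/α)|ψ⟩` satisfies `(|0^m⟩⟨0^m| ⊗ 𝟙)|Ψ^⊥⟩ = 0`;
* **`success_weight`** — the squared norm of the `|0^m⟩`-component is `‖M|ψ⟩‖²/α²` ("this
  successful outcome occurs with probability `(‖M|ψ⟩‖/α)²`");
* `selectOp_conjTranspose_mul_selectOp` — if every `U_i` is unitary then so is `U`;
* `lcuOp_block_two` — the introductory example: two terms with `α = (1, 1)` and any `V` whose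
  `i₀`-column is `(1/√2, 1/√2)` (e.g. a Hadamard) give the block `(U_0 + U_1)/2`.

NOT here: Lemma 7 (non-unitary LCU with amplitude amplification), Lemma 8 / Corollary 10, gate
counts, and the generalisation to blocks `T_i` of unitaries.
-/

namespace Literature.Computability.QuantumAlgorithms

open Matrix Finset Complex

namespace LCU

variable {ι n : Type*} [Fintype ι] [DecidableEq ι] [Fintype n] [DecidableEq n]

/-! ## §1 The operators -/

/-- `U := ∑_i |i⟩⟨i| ⊗ U_i` — "implements `U_i` conditioned on the value of a control register".
[cite: ChildsKothariSomma2017, §2.1 (before Lemma 6)] -/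
def selectOp (U : ι → Matrix n n ℂ) : Matrix (ι × n) (ι × n) ℂ :=
  fun p q => if p.1 = q.1 then U p.1 p.2 q.2 else 0

/-- `V ⊗ 𝟙`: an operator `V` on the control register, doing nothing to the system.
[cite: ChildsKothariSomma2017, §2.1 (the operation `V`)] -/
def onControl (V : Matrix ι ι ℂ) : Matrix (ι × n) (ι × n) ℂ :=
  fun p q => if p.2 = q.2 then V p.1 q.1 else 0

/-- `W := V† U V` (with `V` acting on the control register).
[cite: ChildsKothariSomma2017, Lemma 6] -/
def lcuOp (V : Matrix ι ι ℂ) (U : ι → Matrix n n ℂ) : Matrix (ι × n) (ι × n) ℂ :=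
  onControl Vᴴ * selectOp U * onControl V

/-- `|i⟩|ψ⟩`. [cite: ChildsKothariSomma2017, Lemma 6 (the states `|0^m⟩|ψ⟩`)] -/
def ketTensor (i : ι) (ψ : n → ℂ) : ι × n → ℂ := fun p => if p.1 = i then ψ p.2 else 0

/-- `|i₀⟩⟨i₀| ⊗ 𝟙`, the projector onto the control register reading `|0^m⟩`.
[cite: ChildsKothariSomma2017, Lemma 6 (`(|0^m⟩⟨0^m| ⊗ 𝟙)|Ψ^⊥⟩ = 0`)] -/
def projControl (i₀ : ι) : Matrix (ι × n) (ι × n) ℂ :=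
  fun p q => if p = q ∧ p.1 = i₀ then 1 else 0

/-- `M = ∑_i α_i U_i`. [cite: ChildsKothariSomma2017, Lemma 6] -/
def lincomb (α : ι → ℝ) (U : ι → Matrix n n ℂ) : Matrix n n ℂ := ∑ i, (α i : ℂ) • U i

omit [Fintype n] [DecidableEq ι] [DecidableEq n] in
/-- Entries of `M = ∑_i α_i U_i`. [cite: ChildsKothariSomma2017, Lemma 6] -/
theorem lincomb_apply (α : ι → ℝ) (U : ι → Matrix n n ℂ) (a b : n) :
    lincomb α U a b = ∑ i, (α i : ℂ) * U i a b := by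
  simp [lincomb, Matrix.sum_apply, Matrix.smul_apply]

/-! ## §2 The `|0^m⟩`-block of `W` is `M/α` -/

/-- First two factors: `((V† ⊗ 𝟙) U)_{(i₀,a),(k,d)} = conj(V_{k i₀}) (U_k)_{ad}`.
[cite: ChildsKothariSomma2017, Lemma 6 (proof)] -/
theorem onControl_conjTranspose_mul_selectOp_apply (V : Matrix ι ι ℂ) (U : ι → Matrix n n ℂ)
    (i₀ : ι) (a : n) (k : ι) (d : n) :
    (onControl (n := n) Vᴴ * selectOp U) (i₀, a) (k, d) = star (V k i₀) * U k a d := by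
  rw [Matrix.mul_apply, Fintype.sum_prod_type, Finset.sum_eq_single k]
  · rw [Finset.sum_eq_single a]
    · simp [onControl, selectOp]
    · intro c _ hc
      simp [onControl, Ne.symm hc]
    · intro h; exact absurd (Finset.mem_univ a) h
  · intro j _ hj
    exact Finset.sum_eq_zero fun c _ => by simp [selectOp, hj]
  · intro h; exact absurd (Finset.mem_univ k) h

/-- The entries of `W = V†UV` between control label `i₀` and control label `i₀`:
`W_{(i₀,a),(i₀,b)} = ∑_j conj(V_{j i₀}) V_{j i₀} (U_j)_{ab}` — the one-line computation of the
printed proof ("as shown in [Kot14]"). [cite: ChildsKothariSomma2017, Lemma 6 (proof)] -/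
theorem lcuOp_apply_zero_zero (V : Matrix ι ι ℂ) (U : ι → Matrix n n ℂ) (i₀ : ι) (a b : n) :
    lcuOp V U (i₀, a) (i₀, b) = ∑ j, star (V j i₀) * V j i₀ * U j a b := by
  unfold lcuOp
  rw [Matrix.mul_apply, Fintype.sum_prod_type]
  refine Finset.sum_congr rfl fun k _ => ?_
  rw [Finset.sum_eq_single b]
  · rw [onControl_conjTranspose_mul_selectOp_apply]
    simp only [onControl, if_true]
    ring
  · intro d _ hd
    simp [onControl, hd]
  · intro h; exact absurd (Finset.mem_univ b) h

/-- **The `|0^m⟩`-block of `W` is `M/α`**: if `V i i₀ = √(α_i/α)` for every `i`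
(i.e. `V|0^m⟩ = (1/√α) ∑_i √α_i |i⟩`), with `α_i ≥ 0` and `α = ∑_i α_i > 0`, then
`W_{(i₀,a),(i₀,b)} = (1/α) (∑_i α_i U_i)_{ab}`. [cite: ChildsKothariSomma2017, Lemma 6] -/
theorem lcuOp_block {α : ι → ℝ} (hα : ∀ i, 0 ≤ α i) (hs : 0 < ∑ i, α i) {V : Matrix ι ι ℂ}
    {i₀ : ι} (hV : ∀ i, V i i₀ = (Real.sqrt (α i / ∑ j, α j) : ℂ)) (U : ι → Matrix n n ℂ)
    (a b : n) :
    lcuOp V U (i₀, a) (i₀, b) = (1 / (∑ j, α j : ℝ) : ℂ) * lincomb α U a b := by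
  rw [lcuOp_apply_zero_zero, lincomb_apply, Finset.mul_sum]
  refine Finset.sum_congr rfl fun j _ => ?_
  have hj : 0 ≤ α j / ∑ k, α k := div_nonneg (hα j) hs.le
  have hsq : star (V j i₀) * V j i₀ = ((α j / ∑ k, α k : ℝ) : ℂ) := by
    rw [hV j, Complex.star_def, Complex.conj_ofReal, ← Complex.ofReal_mul,
      Real.mul_self_sqrt hj]
  rw [hsq]
  push_cast
  have hs' : ((∑ k, α k : ℝ) : ℂ) ≠ 0 := by exact_mod_cast hs.ne'
  field_simp

/-! ## §3 Lemma 6 on states, the remainder, the success probability -/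

/-- **Lemma 6** on vectors: the `|0^m⟩`-component of `W|0^m⟩|ψ⟩` is `(1/α) M|ψ⟩`.
[cite: ChildsKothariSomma2017, Lemma 6] -/
theorem lcuOp_mulVec_ketTensor_zero {α : ι → ℝ} (hα : ∀ i, 0 ≤ α i) (hs : 0 < ∑ i, α i)
    {V : Matrix ι ι ℂ} {i₀ : ι} (hV : ∀ i, V i i₀ = (Real.sqrt (α i / ∑ j, α j) : ℂ))
    (U : ι → Matrix n n ℂ) (ψ : n → ℂ) (a : n) :
    (lcuOp V U *ᵥ ketTensor i₀ ψ) (i₀, a)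
      = (1 / (∑ j, α j : ℝ) : ℂ) * (lincomb α U *ᵥ ψ) a := by
  simp only [Matrix.mulVec, dotProduct]
  rw [Fintype.sum_prod_type, Finset.sum_eq_single i₀]
  · have hR : (1 / (∑ j, α j : ℝ) : ℂ) * ∑ b, lincomb α U a b * ψ b
        = ∑ b, ((1 / (∑ j, α j : ℝ) : ℂ) * lincomb α U a b) * ψ b := by
      rw [Finset.mul_sum]
      exact Finset.sum_congr rfl fun b _ => by ring
    rw [hR]
    refine Finset.sum_congr rfl fun b _ => ?_
    rw [lcuOp_block hα hs hV U a b]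
    simp [ketTensor]
  · intro k _ hk
    exact Finset.sum_eq_zero fun d _ => by simp [ketTensor, hk]
  · intro h; exact absurd (Finset.mem_univ i₀) h

/-- `(|0^m⟩⟨0^m| ⊗ 𝟙)` keeps exactly the `|0^m⟩`-components. [cite: ChildsKothariSomma2017,
Lemma 6 (the projector `|0^m⟩⟨0^m| ⊗ 𝟙`)] -/
theorem projControl_mulVec_apply (i₀ i : ι) (v : ι × n → ℂ) (a : n) :
    (projControl i₀ *ᵥ v) (i, a) = if i = i₀ then v (i, a) else 0 := by
  simp only [Matrix.mulVec, dotProduct, projControl]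
  by_cases h : i = i₀
  · rw [if_pos h, Finset.sum_eq_single (i, a)]
    · simp [h]
    · intro q _ hq
      simp [Ne.symm hq]
    · intro h'; exact absurd (Finset.mem_univ (i, a)) h'
  · rw [if_neg h]
    exact Finset.sum_eq_zero fun q _ => by simp [h]

/-- The remainder `|Ψ^⊥⟩ := W|0^m⟩|ψ⟩ − |0^m⟩ (M/α)|ψ⟩` has no `|0^m⟩`-component:
`(|0^m⟩⟨0^m| ⊗ 𝟙)|Ψ^⊥⟩ = 0`. [cite: ChildsKothariSomma2017, Lemma 6] -/
theorem proj_remainder_eq_zero {α : ι → ℝ} (hα : ∀ i, 0 ≤ α i) (hs : 0 < ∑ i, α i)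
    {V : Matrix ι ι ℂ} {i₀ : ι} (hV : ∀ i, V i i₀ = (Real.sqrt (α i / ∑ j, α j) : ℂ))
    (U : ι → Matrix n n ℂ) (ψ : n → ℂ) :
    projControl i₀ *ᵥ (lcuOp V U *ᵥ ketTensor i₀ ψ
        - ketTensor i₀ (((1 / (∑ j, α j : ℝ) : ℂ)) • (lincomb α U *ᵥ ψ))) = 0 := by
  ext ⟨i, a⟩
  rw [projControl_mulVec_apply, Pi.zero_apply]
  by_cases hi : i = i₀
  · subst hi
    rw [if_pos rfl, Pi.sub_apply, lcuOp_mulVec_ketTensor_zero hα hs hV U ψ a]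
    simp [ketTensor]
  · rw [if_neg hi]

/-- **"This successful outcome occurs with probability `(‖M|ψ⟩‖/α)²`"**: the squared norm of
the `|0^m⟩`-component of `W|0^m⟩|ψ⟩` is `‖M|ψ⟩‖²/α²`.
[cite: ChildsKothariSomma2017, §2.1 (text after Lemma 6)] -/
theorem success_weight {α : ι → ℝ} (hα : ∀ i, 0 ≤ α i) (hs : 0 < ∑ i, α i)
    {V : Matrix ι ι ℂ} {i₀ : ι} (hV : ∀ i, V i i₀ = (Real.sqrt (α i / ∑ j, α j) : ℂ))
    (U : ι → Matrix n n ℂ) (ψ : n → ℂ) :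
    ∑ a, ‖(lcuOp V U *ᵥ ketTensor i₀ ψ) (i₀, a)‖ ^ 2
      = (1 / (∑ j, α j)) ^ 2 * ∑ a, ‖(lincomb α U *ᵥ ψ) a‖ ^ 2 := by
  rw [Finset.mul_sum]
  refine Finset.sum_congr rfl fun a _ => ?_
  rw [lcuOp_mulVec_ketTensor_zero hα hs hV U ψ a, norm_mul, mul_pow]
  congr 1
  rw [norm_div, norm_one, Complex.norm_real, Real.norm_eq_abs, abs_of_pos hs]

/-! ## §4 Unitarity of the select operation; the two-term example -/

/-- If every `U_i` is unitary (`U_i† U_i = 𝟙`) then `U = ∑_i |i⟩⟨i| ⊗ U_i` is unitary.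
[cite: ChildsKothariSomma2017, §2.1 ("unitary operations U and V")] -/
theorem selectOp_conjTranspose_mul_selectOp {U : ι → Matrix n n ℂ}
    (hU : ∀ i, (U i)ᴴ * U i = 1) : (selectOp U)ᴴ * selectOp U = 1 := by
  ext ⟨i, a⟩ ⟨j, b⟩
  rw [Matrix.mul_apply, Fintype.sum_prod_type, Finset.sum_eq_single i]
  · by_cases hij : i = j
    · subst hij
      have h := congrFun (congrFun (hU i) a) b
      simp only [Matrix.mul_apply, conjTranspose_apply] at h
      simp only [conjTranspose_apply, selectOp, if_true]
      rw [h, Matrix.one_apply, Matrix.one_apply]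
      simp
    · have h0 : (1 : Matrix (ι × n) (ι × n) ℂ) (i, a) (j, b) = 0 := by
        rw [Matrix.one_apply, if_neg]
        simp [hij]
      rw [h0]
      exact Finset.sum_eq_zero fun c _ => by simp [selectOp, hij]
  · intro k _ hk
    exact Finset.sum_eq_zero fun c _ => by simp [selectOp, conjTranspose_apply, hk]
  · intro h; exact absurd (Finset.mem_univ i) h

/-- The introductory example: `M = U_0 + U_1` with the control qubit prepared in `|+⟩` — any `V`
whose `i₀`-column is `(1/√2, 1/√2)` (for instance the Hadamard gate) gives the block
`(U_0 + U_1)/2`, i.e. postselecting `|+⟩` "prepare[s] a state proportional to `M|ψ⟩`".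
[cite: ChildsKothariSomma2017, §1 (the `M = U_0 + U_1` example), Lemma 6] -/
theorem lcuOp_block_two {V : Matrix (Fin 2) (Fin 2) ℂ} {i₀ : Fin 2}
    (hV : ∀ i, V i i₀ = (Real.sqrt (1 / 2) : ℂ)) (U : Fin 2 → Matrix n n ℂ) (a b : n) :
    lcuOp V U (i₀, a) (i₀, b) = (1 / 2 : ℂ) * (U 0 a b + U 1 a b) := by
  have hα : ∀ i : Fin 2, (0 : ℝ) ≤ (fun _ => (1 : ℝ)) i := fun _ => zero_le_one
  have hs : (0 : ℝ) < ∑ i : Fin 2, (fun _ => (1 : ℝ)) i := by simp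
  have hV' : ∀ i, V i i₀ = (Real.sqrt ((fun _ => (1 : ℝ)) i / ∑ j : Fin 2, (fun _ => (1 : ℝ)) j) : ℂ) := by
    intro i; rw [hV i]; norm_num
  rw [lcuOp_block hα hs hV' U a b, lincomb_apply]
  simp [Fin.sum_univ_two]

end LCU

end Literature.Computability.QuantumAlgorithms
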